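import Mathlib
import HarnessLib
import Summits.NavierStokesRegularity.NavierStokesRegularity.Theses.SymmetryModuliCount
import Literature.Analysis.FluidPDE.TypeIAncientMild
import Summits.NavierStokesRegularity.NavierStokesRegularity.Theorems.SymmetryModuliCountAxisymEndLiouvilleOfFarPastLedgerCubic
import Summits.NavierStokesRegularity.NavierStokesRegularity.Theorems.SymmetryModuliCountForcedSymmetryStubLerayRateEnergy
import Summits.NavierStokesRegularity.NavierStokesRegularity.Theorems.SymmetryModuliCountForcedSymmetryStubBlowDownDriverStPull
import Summits.NavierStokesRegularity.NavierStokesRegularity.Theorems.SymmetryModuliCountForcedSymmetryUniqueBlowDown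
import Summits.NavierStokesRegularity.NavierStokesRegularity.Theorems.SymmetryModuliCountForcedSymmetrySelfSimilarVertexLeaf
import Summits.NavierStokesRegularity.NavierStokesRegularity.Theorems.SymmetryModuliCountForcedSymmetryBlowDownCentre

/-!
# Crux `ForcedSymmetry` (stmt-NavierStokesRegularity-4052), line `blow-down-census`:
# what the line proves UNCONDITIONALLY — Liouville for elements with a convergent blow-down, and
# the tightness of the X-strength stub

Route `SymmetryModuliCount`, sub-problem `NavierStokesRegularity`.  Lead file (gen 2, seat `-1`).

Let `A_C = {v : IsTypeIAncientMild C v}` be the Type-I KNSS-mild ancient class.  Hypotheses of this file are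
the two KNOWN-TYPE inputs of the line, both landing under the sibling crux stmt-14060: the far-past ledger
`FarPastLedger` (route item) and the pressure package of the ledger class (the registered stub
`stub_pressurePackage`, = `stub_pressurePackage_of_slicePressure` applied to 14060's `stub_fplSlicePressure`).

* `liouville_of_tendsto_blowDown` — **the blow-down-census line closes X on the asymptotically self-similar
  part of the class**: if `v ∈ A_C` has, at every centre `(t₁, x₁)` with `t₁ ≤ 0`, a CONVERGENT blow-down family
  `c v(t₁ + c² s, x₁ + c y) → W(s, y)` (`c → ∞`, pointwise on `s < 0`; the card's `UniqueBlowDown`), then `v ≡ 0`.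
  Proof = the line: ledger ⇒ cubic bound + pressure package ⇒ the landed driver `stub_blowDownDriver` produces at a
  point where `v ≠ 0` a subsequential blow-down limit `W ∈ A_C`, backward-SINGULAR at the origin; it is the limit of
  the whole family there, hence scaling-invariant (`generator_eq_zero_of_tendsto_blowDown`, landed), hence zero by
  the self-similar vertex leaf (`selfSimilarOriginVertex_vanishes`, landed: Tsai 1998 Thm 1 in the KNSS gauge) —
  but a field vanishing on `s < 0` is not singular.  This is the ancient/blow-DOWN analogue of Chae's exclusion of
  asymptotically self-similar blow-UP (Chae 2007, Thm 1.1), with pointwise `C_loc` convergence in place of `Lᵖ`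
  convergence of the profile, the ledger supplying the local energy class.
* `blowDownLimitSelfSimilar_iff_typeIAncientLiouville` — **tightness of the registered X-strength stub**
  `stub_blowDownLimitSelfSimilar` (skeleton `Cruxes/ForcedSymmetry/Lines/blow_down_census.lean`, lead c1's
  registration): given the two known-type inputs it is EQUIVALENT to the route target `X = TypeIAncientLiouville`
  (⇒: the line's composition over the landed general driver; ⇐: `A_C = {0}` and the zero field has vanishing
  generator).  Hence the stub is exactly crux-sized (`ForcedSymmetry ⇔ X`, `Theorems/…ForcedSymmetryCollapse`).
-/

noncomputable section

-- the summit and its single problem share the name (D-0017 nested layout)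
set_option linter.dupNamespace false

open MeasureTheory Set Metric Filter Function TopologicalSpace
open scoped ENNReal NNReal Topology
open Literature.Analysis.FluidPDE
open Summit.NavierStokesRegularity.NavierStokesRegularity.Theses.SymmetryModuliCount
open Summit.NavierStokesRegularity.NavierStokesRegularity.Theorems
open Summit.NavierStokesRegularity.NavierStokesRegularity.Theorems.AxisymEndLiouvilleOfFarPastLedger
  (lintegral_parabolicCylinder_le)

namespace Summit.NavierStokesRegularity.NavierStokesRegularity.Theorems.SymmetryModuliCountForcedSymmetry

/-! ### Small tools -/

/-- A field that vanishes identically on `s < 0` is NOT backward-singular at the space–time origin: it is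
essentially zero, hence essentially bounded, on the unit backward parabolic ball `Q(0,1) ⊆ {s < 0}`. [folklore] -/
theorem not_isBackwardSingularPoint_zero_of_vanishes
    {W : ℝ → EuclideanSpace ℝ (Fin 3) → EuclideanSpace ℝ (Fin 3)} (h : ∀ s < 0, ∀ y, W s y = 0) :
    ¬ IsBackwardSingularPoint W 0 := by
  intro hsing
  have h1 := hsing 1 one_pos
  have hQm : MeasurableSet (parabolicCylinder 1 (0 : ℝ × EuclideanSpace ℝ (Fin 3))) :=
    (isOpen_parabolicCylinder _ _).measurableSet
  have hae : (uncurry W) =ᵐ[volume.restrict (parabolicCylinder 1 (0 : ℝ × EuclideanSpace ℝ (Fin 3)))] 0 := by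
    filter_upwards [ae_restrict_mem hQm] with z hz
    have hs : z.1 < 0 := by
      have := (mem_parabolicCylinder.1 hz).1.2
      simpa using this
    simp [uncurry, h z.1 hs z.2]
  rw [eLpNorm_congr_ae hae, eLpNorm_zero] at h1
  exact ENNReal.zero_ne_top h1

/-- The zero field has vanishing scaling generator: if `W ≡ 0` on `s < 0` then
`D(W s)(y) y + W s y + 2s ∂ₛW(s, y) = 0` there (the slice is the zero function, and the time orbit is eventually
zero near `s`). [folklore] -/
theorem generator_eq_zero_of_vanishes
    {W : ℝ → EuclideanSpace ℝ (Fin 3) → EuclideanSpace ℝ (Fin 3)} (h : ∀ s < 0, ∀ y, W s y = 0)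
    {s : ℝ} (hs : s < 0) (y : EuclideanSpace ℝ (Fin 3)) :
    fderiv ℝ (W s) y y + W s y + (2 * s) • timeDeriv W s y = 0 := by
  have hWs : W s = fun _ => 0 := funext (h s hs)
  have hd : timeDeriv W s y = 0 := by
    rw [timeDeriv_apply]
    have hconst : (fun τ => W τ y) =ᶠ[𝓝 s] fun _ => 0 := by
      filter_upwards [Iio_mem_nhds hs] with τ hτ
      exact h τ hτ y
    rw [hconst.deriv_eq]
    simp
  rw [hd, hWs]
  simp

/-- The uniform cubic bound of the ledger class on the unit parabolic ball (landed
`lintegral_parabolicCylinder_le` at the centre `0`, radius `1`). [folklore] -/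
theorem cubic_of_ledger {C K : ℝ} :
    ∀ w : ℝ → EuclideanSpace ℝ (Fin 3) → EuclideanSpace ℝ (Fin 3), IsTypeIAncientMild C w →
      (∀ t < 0, ∀ (x₀ : EuclideanSpace ℝ (Fin 3)) (R : ℝ), 0 < R →
        ∫ x in ball x₀ R, ‖w t x‖ ^ 2 ≤ K * R) →
      ∫⁻ z in parabolicCylinder 1 (0 : ℝ × EuclideanSpace ℝ (Fin 3)), ‖w z.1 z.2‖ₑ ^ (3 : ℕ) ≤
        ENNReal.ofReal (2 * C * K) := by
  intro w hw hKw
  have key := lintegral_parabolicCylinder_le hw hKw (z := (0 : ℝ × EuclideanSpace ℝ (Fin 3))) le_rfl one_pos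
  simpa using key

/-! ### Liouville on the asymptotically self-similar part of the class -/

/-- **Liouville for Type-I ancient mild solutions with convergent blow-downs** (what the line `blow-down-census`
proves unconditionally, given the two known-type inputs `FarPastLedger` and the pressure package of the ledger
class): if `v ∈ A_C` has at every centre `(t₁, x₁)`, `t₁ ≤ 0`, a pointwise-convergent blow-down family
`c v(t₁ + c² s, x₁ + c y) → W(s, y)` on `s < 0` as `c → ∞`, then `v ≡ 0` on `t < 0`.  (Ledger ⇒ driver: a
subsequential blow-down limit in `A_C`, singular at the origin; it is the full-family limit, hence scaling
invariant, hence zero by the self-similar vertex leaf — contradiction.) [cite: AlbrittonBarker2019, Lemma 2.2, Prop. 2.3, §3; Tsai1998, Thm 1] -/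
theorem liouville_of_tendsto_blowDown (hL : FarPastLedger)
    (hP : ∀ (C K : ℝ), ∃ D₀ : ℝ,
      ∀ w : ℝ → EuclideanSpace ℝ (Fin 3) → EuclideanSpace ℝ (Fin 3), IsTypeIAncientMild C w →
        (∀ t < 0, ∀ (x₀ : EuclideanSpace ℝ (Fin 3)) (R : ℝ), 0 < R →
          ∫ x in ball x₀ R, ‖w t x‖ ^ 2 ≤ K * R) →
        ∀ T ∈ Ioc (0 : ℝ) 1, ∃ q : ℝ → EuclideanSpace ℝ (Fin 3) → ℝ,
          IsSuitableWeakSolutionInBall 1 0 (fun s y => w (s - T) y) q ∧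
          ∫⁻ z in parabolicCylinder 1 (0 : ℝ × EuclideanSpace ℝ (Fin 3)), ‖q z.1 z.2‖ₑ ^ (3 / 2 : ℝ) ≤
            ENNReal.ofReal D₀) :
    ∀ (C : ℝ) (v : ℝ → EuclideanSpace ℝ (Fin 3) → EuclideanSpace ℝ (Fin 3)), IsTypeIAncientMild C v →
      (∀ t₁ ≤ (0 : ℝ), ∀ x₁ : EuclideanSpace ℝ (Fin 3),
        ∃ W : ℝ → EuclideanSpace ℝ (Fin 3) → EuclideanSpace ℝ (Fin 3), ∀ s < (0 : ℝ), ∀ y : EuclideanSpace ℝ (Fin 3),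
          Tendsto (fun c : ℝ => c • v (t₁ + c ^ 2 * s) (x₁ + c • y)) atTop (𝓝 (W s y))) →
      ∀ t < 0, ∀ x, v t x = 0 := by
  intro C v hv hconv t ht x
  by_contra hx
  -- the ledger, the pressure package and the cubic bound of the class `A_C ∩ {ledger K}`
  obtain ⟨K, hK⟩ := stub_lerayRateEnergy_of_farPastLedger hL C v hv
  obtain ⟨D₀, hD₀⟩ := hP C K
  -- blow down at `(t, x)`: a subsequential limit `W ∈ A_C`, singular at the origin
  obtain ⟨t₁, x₁, c, W, ht₁, hcpos, hctop, hW, hpt, hsing⟩ :=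
    stub_blowDownDriver C K D₀ cubic_of_ledger hD₀ v hv hK t ht x hx
  -- the whole family converges at this centre, to some `W'`, which must agree with `W` on `s < 0`
  obtain ⟨W', hW'⟩ := hconv t₁ ht₁ x₁
  have hWW' : ∀ s < (0 : ℝ), ∀ y : EuclideanSpace ℝ (Fin 3), W' s y = W s y := by
    intro s hs y
    have h1 : Tendsto (fun k => c k • v (t₁ + c k ^ 2 * s) (x₁ + c k • y)) atTop (𝓝 (W' s y)) :=
      (hW' s hs y).comp hctop
    have h2 : Tendsto (fun k => c k • v (t₁ + c k ^ 2 * s) (x₁ + c k • y)) atTop (𝓝 (W s y)) := by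
      simpa only [smul_stPull_apply] using hpt s hs y
    exact tendsto_nhds_unique h1 h2
  have hfull : ∀ s < (0 : ℝ), ∀ y : EuclideanSpace ℝ (Fin 3),
      Tendsto (fun c : ℝ => c • v (t₁ + c ^ 2 * s) (x₁ + c • y)) atTop (𝓝 (W s y)) := by
    intro s hs y
    rw [← hWW' s hs y]
    exact hW' s hs y
  -- so `W` is scaling invariant, hence annihilated by the scaling generator, hence zero on `s < 0`
  have hgen := generator_eq_zero_of_tendsto_blowDown hW hfull
  have hW0 : ∀ s < 0, ∀ y, W s y = 0 := selfSimilarOriginVertex_vanishes C W hW hgen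
  -- but `W` is singular at the origin
  exact not_isBackwardSingularPoint_zero_of_vanishes hW0 hsing

/-! ### Tightness of the X-strength stub -/

/-- **The registered X-strength stub of the line is equivalent to the route target.**  Given `FarPastLedger` and
the pressure package of the ledger class, the statement of `stub_blowDownLimitSelfSimilar` (skeleton
`Cruxes/ForcedSymmetry/Lines/blow_down_census.lean`: every slice-wise pointwise and locally uniform blow-down limit
`W ∈ A_C` of an element of `A_C ∩ {ledger}` is annihilated by the scaling generator) holds if and only if
`X = TypeIAncientLiouville` does.  (⇒) is the line's composition over the landed general driver
`Theorems.ForcedSymmetry.BlowDownCensus.stub_blowDownDriver` and the self-similar vertex leaf; (⇐) because then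
`A_C = {0}` and the zero field has vanishing generator. [cite: AlbrittonBarker2019, Lemma 2.2, Prop. 2.3, §3; Tsai1998, Thm 1] -/
theorem blowDownLimitSelfSimilar_iff_typeIAncientLiouville (hL : FarPastLedger)
    (hP : ∀ (C K : ℝ), ∃ D₀ : ℝ,
      ∀ w : ℝ → EuclideanSpace ℝ (Fin 3) → EuclideanSpace ℝ (Fin 3), IsTypeIAncientMild C w →
        (∀ t < 0, ∀ (x₀ : EuclideanSpace ℝ (Fin 3)) (R : ℝ), 0 < R →
          ∫ x in ball x₀ R, ‖w t x‖ ^ 2 ≤ K * R) →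
        ∀ T ∈ Ioc (0 : ℝ) 1, ∃ q : ℝ → EuclideanSpace ℝ (Fin 3) → ℝ,
          IsSuitableWeakSolutionInBall 1 0 (fun s y => w (s - T) y) q ∧
          ∫⁻ z in parabolicCylinder 1 (0 : ℝ × EuclideanSpace ℝ (Fin 3)), ‖q z.1 z.2‖ₑ ^ (3 / 2 : ℝ) ≤
            ENNReal.ofReal D₀) :
    (∀ (C K : ℝ) (v : ℝ → EuclideanSpace ℝ (Fin 3) → EuclideanSpace ℝ (Fin 3)), IsTypeIAncientMild C v →
      (∀ t < 0, ∀ (x₀ : EuclideanSpace ℝ (Fin 3)) (R : ℝ), 0 < R →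
        ∫ x in ball x₀ R, ‖v t x‖ ^ 2 ≤ K * R) →
      ∀ (t₁ : ℝ) (x₁ : EuclideanSpace ℝ (Fin 3)), t₁ < 0 →
      ∀ (c : ℕ → ℝ), (∀ k, 0 < c k) → Tendsto c atTop atTop →
      ∀ (W : ℝ → EuclideanSpace ℝ (Fin 3) → EuclideanSpace ℝ (Fin 3)), IsTypeIAncientMild C W →
        (∀ s < 0, ∀ y, Tendsto (fun k => c k • v (t₁ + c k ^ 2 * s) (x₁ + c k • y)) atTop (𝓝 (W s y))) →
        (∀ s < 0, TendstoLocallyUniformly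
          (fun k (y : EuclideanSpace ℝ (Fin 3)) => c k • v (t₁ + c k ^ 2 * s) (x₁ + c k • y)) (W s) atTop) →
        ∀ s < 0, ∀ y, fderiv ℝ (W s) y y + W s y + (2 * s) • timeDeriv W s y = 0) ↔
    TypeIAncientLiouville := by
  constructor
  · -- (⇒): the line's composition
    intro hS4 C u hu t ht x
    have hA : IsTypeIAncientMild C u := isTypeIAncientMild_iff.2 hu
    by_contra hx
    obtain ⟨K, hK⟩ := stub_lerayRateEnergy_of_farPastLedger hL C u hA
    obtain ⟨D₀, hD₀⟩ := hP C K
    obtain ⟨t₁, x₁, c, U, W, ht₁, hcpos, hctop, hW, hpt, hlu, hsing, hUW⟩ :=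
      Summit.NavierStokesRegularity.NavierStokesRegularity.Theorems.ForcedSymmetry.BlowDownCensus.stub_blowDownDriver
        C K D₀ cubic_of_ledger hD₀ u hA hK t x ht hx
    have hss := hS4 C K u hA hK t₁ x₁ ht₁ c hcpos hctop W hW hpt hlu
    have hW0 : ∀ s < 0, ∀ y, W s y = 0 := selfSimilarOriginVertex_vanishes C W hW hss
    exact not_isBackwardSingularPoint_zero_of_vanishes hW0
      (isBackwardSingularPoint_zero_of_ae_eq one_half_pos hsing hUW)
  · -- (⇐): under `X` the class is `{0}`
    intro hX C K v _ _ t₁ x₁ _ c _ _ W hW _ _ s hs y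
    have hW0 : ∀ s < 0, ∀ y, W s y = 0 := hX C W (isTypeIAncientMild_iff.1 hW)
    exact generator_eq_zero_of_vanishes hW0 hs y

/-! ### One centre suffices -/

/-- **Liouville for Type-I ancient mild solutions with ONE convergent blow-down family.**  Blow-down limits do not
depend on the centre (`tendsto_blowDown_centre`, landed), so in `liouville_of_tendsto_blowDown` convergence of the
blow-down family at a single centre `(t₁, x₁)` with `t₁ ≤ 0` suffices: given `FarPastLedger` and the pressure package
of the ledger class, an element `v ∈ A_C` whose blow-downs `c v(t₁ + c² s, x₁ + c y)` converge pointwise on `s < 0`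
as `c → ∞` vanishes identically. [cite: AlbrittonBarker2019, Lemma 2.2, Prop. 2.3, §3; Tsai1998, Thm 1; KochNadirashviliSereginSverak2009, §4] -/
theorem liouville_of_tendsto_blowDown_at (hL : FarPastLedger)
    (hP : ∀ (C K : ℝ), ∃ D₀ : ℝ,
      ∀ w : ℝ → EuclideanSpace ℝ (Fin 3) → EuclideanSpace ℝ (Fin 3), IsTypeIAncientMild C w →
        (∀ t < 0, ∀ (x₀ : EuclideanSpace ℝ (Fin 3)) (R : ℝ), 0 < R →
          ∫ x in ball x₀ R, ‖w t x‖ ^ 2 ≤ K * R) →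
        ∀ T ∈ Ioc (0 : ℝ) 1, ∃ q : ℝ → EuclideanSpace ℝ (Fin 3) → ℝ,
          IsSuitableWeakSolutionInBall 1 0 (fun s y => w (s - T) y) q ∧
          ∫⁻ z in parabolicCylinder 1 (0 : ℝ × EuclideanSpace ℝ (Fin 3)), ‖q z.1 z.2‖ₑ ^ (3 / 2 : ℝ) ≤
            ENNReal.ofReal D₀) :
    ∀ (C : ℝ) (v : ℝ → EuclideanSpace ℝ (Fin 3) → EuclideanSpace ℝ (Fin 3)), IsTypeIAncientMild C v →
      ∀ t₁ ≤ (0 : ℝ), ∀ x₁ : EuclideanSpace ℝ (Fin 3),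
        (∃ W : ℝ → EuclideanSpace ℝ (Fin 3) → EuclideanSpace ℝ (Fin 3), ∀ s < (0 : ℝ), ∀ y : EuclideanSpace ℝ (Fin 3),
          Tendsto (fun c : ℝ => c • v (t₁ + c ^ 2 * s) (x₁ + c • y)) atTop (𝓝 (W s y))) →
      ∀ t < 0, ∀ x, v t x = 0 := by
  intro C v hv t₁ ht₁ x₁ hW
  obtain ⟨W, hW⟩ := hW
  exact liouville_of_tendsto_blowDown hL hP C v hv fun t₁' ht₁' x₁' =>
    ⟨W, fun s hs y => tendsto_blowDown_centre hv ht₁ ht₁' x₁ x₁' hs y (W s y) (hW s hs y)⟩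

end Summit.NavierStokesRegularity.NavierStokesRegularity.Theorems.SymmetryModuliCountForcedSymmetry

end
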